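import Summits.AtomisticToContinuum.Crystallization.Theorems.FreeSplittingCertificatesStrictSplittingRuleP1FarSiteTail

/-!
# `StrictSplittingRule` (stmt-AtomisticToContinuum-12560): THE EXACT-RULE ALLOCATION `θ_T(e) = J_T / Σ_{T' ∋ e} J_{T'}` and the capacity of a far leg (P1 interpolant object, part 85)

Route `FreeSplittingCertificates`, crux r3 `StrictSplittingRule` (H12⋆ = `stub_coreJointCoercive`), unit b2b-freesplit-B gen 38.
VALUE = second brick of the (B∃) TAIL LEMMA.  Hypothesis (B∃) of `coreJointCoercive_cell_of_certificates₉` (part 83) asks for allocation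
tables `θ, θv` of the readout legs to the cells around them with a per-cell budget for EVERY cell — an infinite family certified outside
the kernel (cellval.py window + celltail.py tail, HOME CERT §31).  Far from the base site the certificate's allocation is the EXACT RULE
(rule v31): the share of cell `T` in leg `e` is `J_T / Σ_{T' around e} J_{T'}` with `J_T = ∫_T χ²|y − y_p|⁻⁶` — the cell's own
capacity integral, which then CANCELS in the per-cell budget.  Here:
* `p1CellJ` (`J_T`), `p1EdgeSet` (the legs both of whose ends are vertices of the cell), `p1CapJ` (`Σ_{T' ∋ e} J_{T'}`), **`p1ThetaX`** (the exact-rule share);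
* `p1CellJ_nonneg`, `isEdge_subset` (the cells around a leg lie in an explicit finite set), `sum_le_p1CapJ` (any finite family of cells
  around the leg bounds the capacity from below), `p1ThetaX_nonneg`, `p1ThetaX_le_div`;
* `fpSq_add_le_sq`, `sq_le_fpSq_add` (triangle inequalities in `fpSq` form);
* **`p1CellJ_ge_of_vertex`** — a cell with a vertex `z`, `‖y_z − y_p‖ = R ≥ 27a/5 + ϱ` (`ϱ² = 4a²/3 + h²`, the star radius of part 80), has
  `J ≥ (√3a²h/12)·((R + ϱ)²)⁻³`;
* **`p1CellDefectG_far_le`** — the exact radial defect of a cell whose vertices are `≥ Ra` from `y_p` is `≤ c(4a²/3 + h²)/((R − 3/2)²a²)·|G|²_F·J_T`.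
NOT a proof of H12⋆, NOT summit progress.  [folklore]
-/

noncomputable section

open Set Function Metric MeasureTheory Filter Topology
open scoped BigOperators NNReal ENNReal Classical

namespace Summit.AtomisticToContinuum.Crystallization.Theorems.StrictSplittingRuleBirth

open Literature.MathematicalPhysics.StatisticalMechanics
open Summit.AtomisticToContinuum.Crystallization.Theorems.PalmUnimodularRigidity.LayeredLawsSelectHcp

/-! ## Definitions -/

/-- **`J_T`** — the capacity integral `∫_T χ²(y − y_p)·|y − y_p|⁻⁶` of cell `T` (the right-hand side integral of the per-cell budget (B)). [folklore] -/
def p1CellJ (a h : ℝ) (p : ℤ × ℤ × ℤ) (T : (ℤ × ℤ × ℤ) × Fin 6) : ℝ :=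
  ∫ y in p1RealCell a h T, fpChi ((81 / 20 * a) ^ 2) ((27 / 5 * a) ^ 2) (y - fun k => hcpSite a h p k) ^ 2 *
    (fpSq (y - fun k => hcpSite a h p k))⁻¹ ^ 3

/-- **The (ordered) edges of a cell** as legs `(x, d)`: `x = y_m`, `x + d = y_{m'}` over all vertex pairs `(m, m')` of `T` (the carrier
property of (B∃) says exactly `e ∈ p1EdgeSet T`, `mem_p1EdgeSet_iff`). [folklore] -/
def p1EdgeSet (T : (ℤ × ℤ × ℤ) × Fin 6) : Finset ((ℤ × ℤ × ℤ) × (ℤ × ℤ × ℤ)) :=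
  (Finset.univ : Finset (Fin 4 × Fin 4)).image fun mm =>
    (T.1 + p1VertOff (p1Par T.1) T.2 mm.1, p1VertOff (p1Par T.1) T.2 mm.2 - p1VertOff (p1Par T.1) T.2 mm.1)

/-- `e ∈ p1EdgeSet T` iff both leg ends are vertices of `T` (the carrier property of hypothesis (B∃)). -/
theorem mem_p1EdgeSet_iff (e : (ℤ × ℤ × ℤ) × (ℤ × ℤ × ℤ)) (T : (ℤ × ℤ × ℤ) × Fin 6) :
    e ∈ p1EdgeSet T ↔ ∃ m m' : Fin 4, e.1 = T.1 + p1VertOff (p1Par T.1) T.2 m ∧ e.1 + e.2 = T.1 + p1VertOff (p1Par T.1) T.2 m' := by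
  simp only [p1EdgeSet, Finset.mem_image, Finset.mem_univ, true_and, Prod.exists]
  constructor
  · rintro ⟨m, m', he⟩
    have h1 : e.1 = T.1 + p1VertOff (p1Par T.1) T.2 m := by rw [← he]
    have h2 : e.2 = p1VertOff (p1Par T.1) T.2 m' - p1VertOff (p1Par T.1) T.2 m := by rw [← he]
    refine ⟨m, m', h1, ?_⟩
    rw [h1, h2, add_assoc, add_sub_cancel]
  · rintro ⟨m, m', h1, h2⟩
    have h3 : e.2 = p1VertOff (p1Par T.1) T.2 m' - p1VertOff (p1Par T.1) T.2 m := by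
      have : e.2 = (e.1 + e.2) - e.1 := by rw [add_sub_cancel_left]
      rw [this, h2, h1, add_sub_add_left_eq_sub]
    exact ⟨m, m', Prod.ext h1.symm h3.symm⟩

/-- **The capacity of a leg**: `Σ_{T' ∋ e} J_{T'}` over the cells around it. [folklore] -/
def p1CapJ (a h : ℝ) (p : ℤ × ℤ × ℤ) (e : (ℤ × ℤ × ℤ) × (ℤ × ℤ × ℤ)) : ℝ :=
  ∑ᶠ T : (ℤ × ℤ × ℤ) × Fin 6, if e ∈ p1EdgeSet T then p1CellJ a h p T else 0

/-- **THE EXACT-RULE SHARE** of cell `T` in leg `e`: `J_T / Σ_{T' ∋ e} J_{T'}` if `e` is an edge of `T`, else `0` (rule v31 of HOME CERT §31 far out). [folklore] -/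
def p1ThetaX (a h : ℝ) (p : ℤ × ℤ × ℤ) (e : (ℤ × ℤ × ℤ) × (ℤ × ℤ × ℤ)) (T : (ℤ × ℤ × ℤ) × Fin 6) : ℝ :=
  if e ∈ p1EdgeSet T then p1CellJ a h p T / p1CapJ a h p e else 0

/-! ## Nonnegativity, finiteness, the capacity from below -/

/-- The capacity integrand is continuous. -/
theorem continuous_capIntegrand {a : ℝ} (ha : 0 < a) (y₀ : Fin 3 → ℝ) :
    Continuous fun y : Fin 3 → ℝ => fpChi ((81 / 20 * a) ^ 2) ((27 / 5 * a) ^ 2) (y - y₀) ^ 2 * (fpSq (y - y₀))⁻¹ ^ 3 := by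
  have hS1 : (0 : ℝ) < (81 / 20 * a) ^ 2 := by positivity
  have hS12 : (81 / 20 * a) ^ 2 < (27 / 5 * a) ^ 2 := by nlinarith
  have h := continuous_fpChi_sq_mul hS1 hS12 (g := fun x => (fpSq x)⁻¹ ^ 3) fun x hx => continuousAt_fpSq_inv_pow hx 3
  exact h.comp (by fun_prop)

/-- `J_T ≥ 0`. -/
theorem p1CellJ_nonneg (a h : ℝ) (p : ℤ × ℤ × ℤ) (T : (ℤ × ℤ × ℤ) × Fin 6) : 0 ≤ p1CellJ a h p T := by
  refine setIntegral_nonneg (isClosed_p1RealCell a h T).measurableSet fun y _ => ?_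
  have := fpSq_nonneg (y - fun k => hcpSite a h p k)
  positivity

/-- The explicit finite set containing every cell around a leg based at `x`. -/
def p1CellsAt (x : ℤ × ℤ × ℤ) : Finset ((ℤ × ℤ × ℤ) × Fin 6) :=
  ((Finset.univ : Finset (Fin 6 × Fin 4)).image fun πm => (x - p1VertOff true πm.1 πm.2, πm.1)) ∪
    ((Finset.univ : Finset (Fin 6 × Fin 4)).image fun πm => (x - p1VertOff false πm.1 πm.2, πm.1))

/-- Every cell having `e.1` as a vertex (in particular every cell around the leg `e`) lies in `p1CellsAt e.1`. -/
theorem isEdge_subset (e : (ℤ × ℤ × ℤ) × (ℤ × ℤ × ℤ)) {T : (ℤ × ℤ × ℤ) × Fin 6} (hT : e ∈ p1EdgeSet T) : T ∈ p1CellsAt e.1 := by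
  obtain ⟨m, m', h1, _⟩ := (mem_p1EdgeSet_iff e T).1 hT
  have hT1 : T.1 = e.1 - p1VertOff (p1Par T.1) T.2 m := by rw [h1]; abel
  simp only [p1CellsAt, Finset.mem_union, Finset.mem_image, Finset.mem_univ, true_and, Prod.exists]
  cases hb : p1Par T.1
  · right
    refine ⟨T.2, m, ?_⟩
    rw [hb] at hT1
    exact Prod.ext hT1.symm rfl
  · left
    refine ⟨T.2, m, ?_⟩
    rw [hb] at hT1
    exact Prod.ext hT1.symm rfl

/-- The support of the capacity summand is finite (inside `p1CellsAt e.1`). -/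
theorem capSummand_support_subset (a h : ℝ) (p : ℤ × ℤ × ℤ) (e : (ℤ × ℤ × ℤ) × (ℤ × ℤ × ℤ)) :
    (Function.support fun T : (ℤ × ℤ × ℤ) × Fin 6 => if e ∈ p1EdgeSet T then p1CellJ a h p T else 0) ⊆ ↑(p1CellsAt e.1) := by
  intro T hT
  rw [Function.mem_support] at hT
  by_cases hE : e ∈ p1EdgeSet T
  · exact isEdge_subset e hE
  · simp [hE] at hT

/-- The capacity as a finite sum. -/
theorem p1CapJ_eq_sum (a h : ℝ) (p : ℤ × ℤ × ℤ) (e : (ℤ × ℤ × ℤ) × (ℤ × ℤ × ℤ)) :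
    p1CapJ a h p e = ∑ T ∈ p1CellsAt e.1, if e ∈ p1EdgeSet T then p1CellJ a h p T else 0 :=
  finsum_eq_sum_of_support_subset _ (capSummand_support_subset a h p e)

/-- **Any finite family of cells around the leg bounds its capacity from below.** -/
theorem sum_le_p1CapJ (a h : ℝ) (p : ℤ × ℤ × ℤ) (e : (ℤ × ℤ × ℤ) × (ℤ × ℤ × ℤ)) (C : Finset ((ℤ × ℤ × ℤ) × Fin 6))
    (hC : ∀ T ∈ C, e ∈ p1EdgeSet T) : ∑ T ∈ C, p1CellJ a h p T ≤ p1CapJ a h p e := by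
  rw [p1CapJ_eq_sum]
  have hsub : C ⊆ p1CellsAt e.1 := fun T hT => isEdge_subset e (hC T hT)
  calc ∑ T ∈ C, p1CellJ a h p T = ∑ T ∈ C, (if e ∈ p1EdgeSet T then p1CellJ a h p T else 0) :=
        Finset.sum_congr rfl fun T hT => by rw [if_pos (hC T hT)]
    _ ≤ ∑ T ∈ p1CellsAt e.1, (if e ∈ p1EdgeSet T then p1CellJ a h p T else 0) := by
        refine Finset.sum_le_sum_of_subset_of_nonneg hsub fun T _ _ => ?_
        split_ifs
        · exact p1CellJ_nonneg a h p T
        · exact le_rfl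

/-- The capacity is nonnegative. -/
theorem p1CapJ_nonneg (a h : ℝ) (p : ℤ × ℤ × ℤ) (e : (ℤ × ℤ × ℤ) × (ℤ × ℤ × ℤ)) : 0 ≤ p1CapJ a h p e := by
  have := sum_le_p1CapJ a h p e ∅ (by simp)
  simpa using this

/-- The share is nonnegative. -/
theorem p1ThetaX_nonneg (a h : ℝ) (p : ℤ × ℤ × ℤ) (e : (ℤ × ℤ × ℤ) × (ℤ × ℤ × ℤ)) (T : (ℤ × ℤ × ℤ) × Fin 6) :
    0 ≤ p1ThetaX a h p e T := by
  unfold p1ThetaX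
  split_ifs
  · exact div_nonneg (p1CellJ_nonneg a h p T) (p1CapJ_nonneg a h p e)
  · exact le_rfl

/-- The share vanishes unless the leg is an edge of the cell. -/
theorem p1ThetaX_eq_zero {a h : ℝ} {p : ℤ × ℤ × ℤ} {e : (ℤ × ℤ × ℤ) × (ℤ × ℤ × ℤ)} {T : (ℤ × ℤ × ℤ) × Fin 6} (hT : ¬e ∈ p1EdgeSet T) :
    p1ThetaX a h p e T = 0 := if_neg hT

/-- **The share against a capacity bound**: if `0 < L ≤ Σ_{T' ∋ e} J_{T'}` then `θ_T(e) ≤ J_T / L`. -/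
theorem p1ThetaX_le_div {a h : ℝ} {p : ℤ × ℤ × ℤ} {e : (ℤ × ℤ × ℤ) × (ℤ × ℤ × ℤ)} (T : (ℤ × ℤ × ℤ) × Fin 6) {L : ℝ} (hL : 0 < L)
    (hcap : L ≤ p1CapJ a h p e) : p1ThetaX a h p e T ≤ p1CellJ a h p T / L := by
  unfold p1ThetaX
  split_ifs
  · exact div_le_div_of_nonneg_left (p1CellJ_nonneg a h p T) hL hcap
  · exact div_nonneg (p1CellJ_nonneg a h p T) hL.le

/-! ## Triangle inequalities in `fpSq` form -/

/-- `|⟪d,u⟫| ≤ R·√(fpSq u)` for `fpSq d = R²`. -/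
theorem abs_fpDot_le_of {d u : Fin 3 → ℝ} {R : ℝ} (hR : 0 ≤ R) (hd : fpSq d = R ^ 2) : |fpDot d u| ≤ R * √(fpSq u) := by
  have hcs := fpDot_sq_le d u
  rw [hd] at hcs
  have h1 : |fpDot d u| = √(fpDot d u ^ 2) := (Real.sqrt_sq_eq_abs _).symm
  rw [h1]
  calc √(fpDot d u ^ 2) ≤ √(R ^ 2 * fpSq u) := Real.sqrt_le_sqrt hcs
    _ = R * √(fpSq u) := by rw [Real.sqrt_mul (sq_nonneg R), Real.sqrt_sq hR]

/-- Upper triangle inequality: `fpSq (d + u) ≤ (R + ρ)²` for `fpSq d = R²`, `fpSq u ≤ ρ²`. -/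
theorem fpSq_add_le_sq {d u : Fin 3 → ℝ} {R ρ : ℝ} (hR : 0 ≤ R) (hρ : 0 ≤ ρ) (hd : fpSq d = R ^ 2) (hu : fpSq u ≤ ρ ^ 2) :
    fpSq (d + u) ≤ (R + ρ) ^ 2 := by
  have hexp : fpSq (d + u) = fpSq d + 2 * fpDot d u + fpSq u := by
    simp only [fpSq, fpDot, Pi.add_apply]; ring
  have habs := abs_fpDot_le_of (u := u) hR hd
  have hsu : √(fpSq u) ≤ ρ := by
    rw [show ρ = √(ρ ^ 2) by rw [Real.sqrt_sq hρ]]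
    exact Real.sqrt_le_sqrt hu
  have h0u : 0 ≤ √(fpSq u) := Real.sqrt_nonneg _
  have hdot : fpDot d u ≤ R * ρ := (le_abs_self _).trans (habs.trans (mul_le_mul_of_nonneg_left hsu hR))
  rw [hexp, hd]
  nlinarith

/-- Lower triangle inequality: `(R − ρ)² ≤ fpSq (d + u)` for `fpSq d = R²`, `fpSq u ≤ ρ²`, `ρ ≤ R`. -/
theorem sq_le_fpSq_add {d u : Fin 3 → ℝ} {R ρ : ℝ} (hρ : 0 ≤ ρ) (hρR : ρ ≤ R) (hd : fpSq d = R ^ 2) (hu : fpSq u ≤ ρ ^ 2) :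
    (R - ρ) ^ 2 ≤ fpSq (d + u) := by
  have hR : 0 ≤ R := hρ.trans hρR
  have hexp : fpSq (d + u) = fpSq d + 2 * fpDot d u + fpSq u := by
    simp only [fpSq, fpDot, Pi.add_apply]; ring
  have habs := abs_fpDot_le_of (u := u) hR hd
  set ρ' := √(fpSq u) with hρ'
  have h0u : 0 ≤ ρ' := Real.sqrt_nonneg _
  have hu' : fpSq u = ρ' ^ 2 := (Real.sq_sqrt (fpSq_nonneg u)).symm
  have hsu : ρ' ≤ ρ := by
    rw [hρ', show ρ = √(ρ ^ 2) by rw [Real.sqrt_sq hρ]]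
    exact Real.sqrt_le_sqrt hu
  have hdot : -(R * ρ') ≤ fpDot d u := by linarith [neg_abs_le (fpDot d u)]
  rw [hexp, hd, hu']
  nlinarith

/-! ## The capacity integral of a far cell from below -/

/-- `0 ≤ 4a²/3 + h²` packaged: the star radius `ϱ = √(4a²/3 + h²)`. -/
theorem starRad_sq (a h : ℝ) : √(4 * a ^ 2 / 3 + h ^ 2) ^ 2 = 4 * a ^ 2 / 3 + h ^ 2 := Real.sq_sqrt (by positivity)

/-- **`J_{T'} ≥ |T'|·(R + ϱ)⁻⁶` for a cell with a vertex `z` at distance `R = ‖y_z − y_p‖ ≥ 27a/5 + ϱ`** (`ϱ = √(4a²/3 + h²)`: every point of the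
cell is within `ϱ` of `y_z` by the star radius of part 80, so `χ ≡ 1` and `|y − y_p| ≤ R + ϱ` on the cell). [folklore] -/
theorem p1CellJ_ge_of_vertex {a h : ℝ} (ha : 0 < a) (hh : 0 < h) (p z : ℤ × ℤ × ℤ) {o : ℤ × ℤ × ℤ} (ho : o ∈ p1Corners)
    {π : Fin 6} {m : Fin 4} (hv : p1VertOff (p1Par (z - o)) π m = o)
    (hR : 27 / 5 * a + √(4 * a ^ 2 / 3 + h ^ 2) ≤ ‖hcpSite a h z - hcpSite a h p‖) :
    √3 * a ^ 2 * h / 12 * (((‖hcpSite a h z - hcpSite a h p‖ + √(4 * a ^ 2 / 3 + h ^ 2)) ^ 2)⁻¹) ^ 3 ≤ p1CellJ a h p (z - o, π) := by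
  set R := ‖hcpSite a h z - hcpSite a h p‖ with hR_def
  set ϱ := √(4 * a ^ 2 / 3 + h ^ 2) with hϱ_def
  have hϱ0 : 0 ≤ ϱ := Real.sqrt_nonneg _
  have hR0 : 0 ≤ R := norm_nonneg _
  have hϱR : ϱ ≤ R := by nlinarith
  have hS12 : (81 / 20 * a) ^ 2 < (27 / 5 * a) ^ 2 := by nlinarith
  set d : Fin 3 → ℝ := fun k => hcpSite a h z k - hcpSite a h p k with hd_def
  have hd : fpSq d = R ^ 2 := by rw [hR_def, norm_sq_eq_three]; simp [fpSq, hd_def]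
  set T : (ℤ × ℤ × ℤ) × Fin 6 := (z - o, π) with hT
  have hK := isCompact_p1RealCell ha.ne' hh.ne' T
  have hmeas : MeasurableSet (p1RealCell a h T) := (isClosed_p1RealCell a h T).measurableSet
  -- pointwise on the cell: `χ = 1` and `s ≤ (R + ϱ)²`
  have hpt : ∀ y ∈ p1RealCell a h T, (((R + ϱ) ^ 2)⁻¹) ^ 3 ≤
      fpChi ((81 / 20 * a) ^ 2) ((27 / 5 * a) ^ 2) (y - fun k => hcpSite a h p k) ^ 2 * (fpSq (y - fun k => hcpSite a h p k))⁻¹ ^ 3 := by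
    intro y hy
    set u : Fin 3 → ℝ := fun k => y k - hcpSite a h z k with hu_def
    have hu : fpSq u ≤ ϱ ^ 2 := by
      rw [hϱ_def, starRad_sq]; exact fpSq_sub_le_of_mem_starCell ha.ne' hh.ne' z ho hv hy
    have hx : (y - fun k => hcpSite a h p k) = d + u := by funext k; simp [hd_def, hu_def]
    rw [hx]
    have hup := fpSq_add_le_sq hR0 hϱ0 hd hu
    have hlo := sq_le_fpSq_add hϱ0 hϱR hd hu
    have h275 : (27 / 5 * a) ^ 2 ≤ fpSq (d + u) := le_trans (by nlinarith) hlo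
    rw [fpChi_eq_one hS12 h275, one_pow, one_mul]
    have hpos : 0 < fpSq (d + u) := lt_of_lt_of_le (by positivity) h275
    have : (fpSq (d + u))⁻¹ ≥ ((R + ϱ) ^ 2)⁻¹ := by
      rw [ge_iff_le, inv_le_inv₀ (by positivity) hpos]; exact hup
    gcongr
  have hvol := volume_p1RealCell ha hh T
  have hint : IntegrableOn (fun y : Fin 3 → ℝ => fpChi ((81 / 20 * a) ^ 2) ((27 / 5 * a) ^ 2) (y - fun k => hcpSite a h p k) ^ 2 *
      (fpSq (y - fun k => hcpSite a h p k))⁻¹ ^ 3) (p1RealCell a h T) volume :=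
    (continuous_capIntegrand ha _).continuousOn.integrableOn_compact hK
  have hconst : IntegrableOn (fun _ : Fin 3 → ℝ => (((R + ϱ) ^ 2)⁻¹) ^ 3) (p1RealCell a h T) volume := by
    refine integrableOn_const ?_
    rw [hvol]; exact ENNReal.ofReal_ne_top
  have hmono := setIntegral_mono_on hconst hint hmeas hpt
  have hc : ∫ _ in p1RealCell a h T, (((R + ϱ) ^ 2)⁻¹) ^ 3 = √3 * a ^ 2 * h / 12 * (((R + ϱ) ^ 2)⁻¹) ^ 3 := by
    rw [setIntegral_const, measureReal_def, hvol, ENNReal.toReal_ofReal (by positivity), smul_eq_mul]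
  rw [hc] at hmono
  exact hmono

/-! ## The exact radial defect of a far cell -/

/-- **The radial defect of a far cell**: if all four vertices of `T` are `≥ R·a` from `y_p` (`R ≥ 7`), then for the radial weight
`c·χ²s⁻⁵xxᵀ` (`c ≥ 0`, `h ≤ 9a/10`): `p1CellDefectG ≤ c·(4a²/3 + h²)/((R − 3/2)²a²)·|G|²_F·J_T` (circumradius form with centre a vertex, majorant
`cχ²s⁻⁴ ≤ cχ²s⁻³/s_min`). [folklore] -/
theorem p1CellDefectG_far_le {a h c R : ℝ} (ha : 0 < a) (hh : 0 < h) (hha : h ≤ 9 / 10 * a) (hc : 0 ≤ c) (hR7 : 7 ≤ R) (p : ℤ × ℤ × ℤ)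
    (T : (ℤ × ℤ × ℤ) × Fin 6) (hfar : ∀ m : Fin 4, R * a ≤ ‖hcpSite a h (T.1 + p1VertOff (p1Par T.1) T.2 m) - hcpSite a h p‖)
    (G : Fin 3 → Fin 3 → ℝ) :
    p1CellDefectG a h (fun y k l => c * fpChi ((81 / 20 * a) ^ 2) ((27 / 5 * a) ^ 2) (y - fun k => hcpSite a h p k) ^ 2 *
        (fpSq (y - fun k => hcpSite a h p k))⁻¹ ^ 5 * ((y - fun k => hcpSite a h p k) k * (y - fun k => hcpSite a h p k) l)) T G ≤
      c * (4 * a ^ 2 / 3 + h ^ 2) / ((R - 3 / 2) ^ 2 * a ^ 2) * fpFrob G * p1CellJ a h p T := by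
  have hS1 : (0 : ℝ) < (81 / 20 * a) ^ 2 := by positivity
  have hS12 : (81 / 20 * a) ^ 2 < (27 / 5 * a) ^ 2 := by nlinarith
  set y₀ : Fin 3 → ℝ := fun k => hcpSite a h p k with hy₀
  set W : (Fin 3 → ℝ) → Fin 3 → Fin 3 → ℝ := fun y k l => c * fpChi ((81 / 20 * a) ^ 2) ((27 / 5 * a) ^ 2) (y - y₀) ^ 2 *
    (fpSq (y - y₀))⁻¹ ^ 5 * ((y - y₀) k * (y - y₀) l) with hW
  have hWc : ∀ k l, Continuous fun y => W y k l := continuous_radWeight_translate hS1 hS12 c y₀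
  have hW0 : ∀ y ∈ p1RealCell a h T, ∀ u, 0 ≤ p1Quad3 (W y) u := fun y _ u => p1Quad3_radWeight_nonneg hc _ _ (y - y₀) u
  have hωc := continuous_bareMajorant_translate hS1 hS12 c y₀
  have hω : ∀ y ∈ p1RealCell a h T, ∀ u : Fin 3 → ℝ, p1Quad3 (W y) u ≤
      (c * fpChi ((81 / 20 * a) ^ 2) ((27 / 5 * a) ^ 2) (y - y₀) ^ 2 * (fpSq (y - y₀))⁻¹ ^ 4) * (u 0 ^ 2 + u 1 ^ 2 + u 2 ^ 2) :=
    fun y _ u => p1Quad3_radWeight_le hc _ _ (y - y₀) u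
  -- centre = vertex 0, radius² = 4a²/3 + h² (star radius, vertices)
  set z : ℤ × ℤ × ℤ := T.1 + p1VertOff (p1Par T.1) T.2 0 with hz
  set o : ℤ × ℤ × ℤ := p1VertOff (p1Par T.1) T.2 0 with ho_def
  have ho : o ∈ p1Corners := p1VertOff_mem_p1Corners _ _ _
  have hzo : z - o = T.1 := by rw [hz]; abel
  have hv : p1VertOff (p1Par (z - o)) T.2 0 = o := by rw [hzo]
  have hTeq : T = (z - o, T.2) := by rw [hzo]
  have hρ : ∀ m : Fin 4, fpSq (fun k => hcpSite a h (T.1 + p1VertOff (p1Par T.1) T.2 m) k - (fun k => hcpSite a h z k) k) ≤ 4 * a ^ 2 / 3 + h ^ 2 := by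
    intro m
    have := p1Star_vertex_fpSq_le a h z ho hv m
    rw [hzo] at this
    exact this
  have hdef := p1CellDefectG_le_rad ha hh T W hWc hW0 hωc hω G hρ
  -- the majorant integral against `J_T`
  set ϱ := √(4 * a ^ 2 / 3 + h ^ 2) with hϱ_def
  have hϱ0 : 0 ≤ ϱ := Real.sqrt_nonneg _
  have hϱle : ϱ ≤ 3 / 2 * a := by
    rw [hϱ_def, show 3 / 2 * a = √((3 / 2 * a) ^ 2) by rw [Real.sqrt_sq (by positivity)]]
    exact Real.sqrt_le_sqrt (by nlinarith)
  set Rz := ‖hcpSite a h z - hcpSite a h p‖ with hRz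
  have hRz0 : 0 ≤ Rz := norm_nonneg _
  have hRa : R * a ≤ Rz := hfar 0
  have hsmin : 0 < (R - 3 / 2) ^ 2 * a ^ 2 := by have : 0 < R - 3 / 2 := by linarith
                                                 positivity
  set d : Fin 3 → ℝ := fun k => hcpSite a h z k - hcpSite a h p k with hd_def
  have hd : fpSq d = Rz ^ 2 := by rw [hRz, norm_sq_eq_three]; simp [fpSq, hd_def]
  have hK := isCompact_p1RealCell ha.ne' hh.ne' T
  have hmeas : MeasurableSet (p1RealCell a h T) := (isClosed_p1RealCell a h T).measurableSet
  have hpt : ∀ y ∈ p1RealCell a h T, c * fpChi ((81 / 20 * a) ^ 2) ((27 / 5 * a) ^ 2) (y - y₀) ^ 2 * (fpSq (y - y₀))⁻¹ ^ 4 ≤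
      c / ((R - 3 / 2) ^ 2 * a ^ 2) * (fpChi ((81 / 20 * a) ^ 2) ((27 / 5 * a) ^ 2) (y - y₀) ^ 2 * (fpSq (y - y₀))⁻¹ ^ 3) := by
    intro y hy
    set u : Fin 3 → ℝ := fun k => y k - hcpSite a h z k with hu_def
    have hy' : y ∈ p1RealCell a h (z - o, T.2) := hTeq ▸ hy
    have hu : fpSq u ≤ ϱ ^ 2 := by
      rw [hϱ_def, starRad_sq]; exact fpSq_sub_le_of_mem_starCell ha.ne' hh.ne' z ho hv hy'
    have hx : (y - y₀) = d + u := by funext k; simp [hd_def, hu_def, hy₀]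
    rw [hx]
    have hlo := sq_le_fpSq_add hϱ0 (by nlinarith) hd hu
    have hlo' : (R - 3 / 2) ^ 2 * a ^ 2 ≤ fpSq (d + u) := by
      have h1 : (R - 3 / 2) * a ≤ Rz - ϱ := by nlinarith
      have h2 : ((R - 3 / 2) * a) ^ 2 ≤ (Rz - ϱ) ^ 2 := pow_le_pow_left₀ (by nlinarith) h1 2
      nlinarith
    have hpos : 0 < fpSq (d + u) := lt_of_lt_of_le hsmin hlo'
    have hinv : (fpSq (d + u))⁻¹ ≤ ((R - 3 / 2) ^ 2 * a ^ 2)⁻¹ := by rw [inv_le_inv₀ hpos hsmin]; exact hlo'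
    have hχ0 : 0 ≤ c * fpChi ((81 / 20 * a) ^ 2) ((27 / 5 * a) ^ 2) (d + u) ^ 2 * (fpSq (d + u))⁻¹ ^ 3 := by
      have := fpSq_nonneg (d + u); positivity
    calc c * fpChi ((81 / 20 * a) ^ 2) ((27 / 5 * a) ^ 2) (d + u) ^ 2 * (fpSq (d + u))⁻¹ ^ 4
        = (c * fpChi ((81 / 20 * a) ^ 2) ((27 / 5 * a) ^ 2) (d + u) ^ 2 * (fpSq (d + u))⁻¹ ^ 3) * (fpSq (d + u))⁻¹ := by ring
      _ ≤ (c * fpChi ((81 / 20 * a) ^ 2) ((27 / 5 * a) ^ 2) (d + u) ^ 2 * (fpSq (d + u))⁻¹ ^ 3) * ((R - 3 / 2) ^ 2 * a ^ 2)⁻¹ :=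
          mul_le_mul_of_nonneg_left hinv hχ0
      _ = c / ((R - 3 / 2) ^ 2 * a ^ 2) * (fpChi ((81 / 20 * a) ^ 2) ((27 / 5 * a) ^ 2) (d + u) ^ 2 * (fpSq (d + u))⁻¹ ^ 3) := by
          rw [div_eq_mul_inv]; ring
  have hint3 : IntegrableOn (fun y : Fin 3 → ℝ => c / ((R - 3 / 2) ^ 2 * a ^ 2) *
      (fpChi ((81 / 20 * a) ^ 2) ((27 / 5 * a) ^ 2) (y - y₀) ^ 2 * (fpSq (y - y₀))⁻¹ ^ 3)) (p1RealCell a h T) volume :=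
    (continuous_const.mul (continuous_capIntegrand ha y₀)).continuousOn.integrableOn_compact hK
  have hint4 : IntegrableOn (fun y : Fin 3 → ℝ => c * fpChi ((81 / 20 * a) ^ 2) ((27 / 5 * a) ^ 2) (y - y₀) ^ 2 * (fpSq (y - y₀))⁻¹ ^ 4)
      (p1RealCell a h T) volume := hωc.continuousOn.integrableOn_compact hK
  have hmono := setIntegral_mono_on hint4 hint3 hmeas hpt
  rw [integral_const_mul] at hmono
  have hJ : (∫ y in p1RealCell a h T, fpChi ((81 / 20 * a) ^ 2) ((27 / 5 * a) ^ 2) (y - y₀) ^ 2 * (fpSq (y - y₀))⁻¹ ^ 3) =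
      p1CellJ a h p T := rfl
  rw [hJ] at hmono
  have hJ0 := p1CellJ_nonneg a h p T
  have hF0 : 0 ≤ fpFrob G := by unfold fpFrob; positivity
  calc p1CellDefectG a h W T G ≤ (∫ y in p1RealCell a h T, c * fpChi ((81 / 20 * a) ^ 2) ((27 / 5 * a) ^ 2) (y - y₀) ^ 2 *
        (fpSq (y - y₀))⁻¹ ^ 4) * ((4 * a ^ 2 / 3 + h ^ 2) * fpFrob G) := hdef
    _ ≤ (c / ((R - 3 / 2) ^ 2 * a ^ 2) * p1CellJ a h p T) * ((4 * a ^ 2 / 3 + h ^ 2) * fpFrob G) :=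
        mul_le_mul_of_nonneg_right hmono (by positivity)
    _ = c * (4 * a ^ 2 / 3 + h ^ 2) / ((R - 3 / 2) ^ 2 * a ^ 2) * fpFrob G * p1CellJ a h p T := by
        rw [div_eq_mul_inv, div_eq_mul_inv]; ring

end Summit.AtomisticToContinuum.Crystallization.Theorems.StrictSplittingRuleBirth

end
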